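import Summits.QuantumFields.BalabanUV.Beta.EriceRemainderEnclosureHistoryAutonomyComparisonAgeCompositionFiveAgesOneBlockWide
import Summits.QuantumFields.BalabanUV.Beta.EriceRemainderEnclosureHistoryAutonomyComparisonAgeCompositionOldTripleCapC2G
import Summits.QuantumFields.BalabanUV.Beta.EriceRemainderEnclosureHistoryAutonomyComparisonAgeCompositionOldTripleCapCG2
import Summits.QuantumFields.BalabanUV.Beta.EriceRemainderEnclosureHistoryAutonomyComparisonAgeCompositionOldTripleCapC3G
import Summits.QuantumFields.BalabanUV.Beta.EriceRemainderEnclosureHistoryAutonomyComparisonAgeCompositionOldTripleCapCG3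
import Summits.QuantumFields.BalabanUV.Beta.EriceRemainderEnclosureHistoryAutonomyComparisonAgeCompositionOldTripleCapC4G
import Summits.QuantumFields.BalabanUV.Beta.EriceRemainderEnclosureHistoryAutonomyComparisonAgeCompositionOldTripleCapCG4
import Summits.QuantumFields.BalabanUV.Beta.EriceRemainderEnclosureHistoryAutonomyComparisonAgeCompositionOldTripleCapC8G
import Summits.QuantumFields.BalabanUV.Beta.EriceRemainderEnclosureHistoryAutonomyComparisonAgeCompositionOldTripleCapCG8

/-!
# EriceRemainderEnclosureHistoryAutonomyComparisonAgeCompositionFiveAgesOneBlockWidest — (E104c) route (N), first order: THE CENSUS FIVE AGES `{1, k₂, k₃, k₄, k₅}`, A TOP RATIO IN (8, 16].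
# The cascade's last step is cheap ((E99g) `flow_nonneg_two_cluster_levels_of_caps`: a capped youngest cluster and ONE capped top cluster close with
# `s₀(ρ₀λ + 4s(1+κ) + κ) ≤ ρ₀λ`, `λ = 1 − s(1+κ)`, any `κ > 0`).  With the youngest cluster the census young pair `{1, k₂}` (`k₂ ≤ 29`, cap `0.8333`,
# (E97c)) and the top cluster the OLD TRIPLE `{k₃, k₄, k₅}` capped by the cell tables of (E103e–zb), the census five ages hold along every admissible flow
# for EVERY `(k₄∕k₃, k₅∕k₄)` in the cell once `k₃ ≥ ρ₀·k₂`, `ρ₀ = ⌈0.8333(4s(1+κ)+κ)∕(λ·0.1667)⌉` at `κ = 1∕1000`: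
# # `flow_nonneg_census_five_ages_c2g` (ρ₀ = 115); `flow_nonneg_census_five_ages_cg2` (ρ₀ = 124); `flow_nonneg_census_five_ages_c3g` (ρ₀ = 124); `flow_nonneg_census_five_ages_cg3` (ρ₀ = 148); `flow_nonneg_census_five_ages_c4g` (ρ₀ = 148); `flow_nonneg_census_five_ages_cg4` (ρ₀ = 164); `flow_nonneg_census_five_ages_c8g` (ρ₀ = 388); `flow_nonneg_census_five_ages_cg8` (ρ₀ = 493);
# **`flow_nonneg_census_five_ages_top8x16`** (`k₄ ≤ 8k₃`, `k₅ ≤ 16k₄`, `388k₂ ≤ k₃`), **`flow_nonneg_census_five_ages_top16x8`** (`k₄ ≤ 16k₃`, `k₅ ≤ 8k₄`, `493k₂ ≤ k₃`).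
# (numerics `HOME/b2b-balaban-beta-d4-p2/g89/numerics/five_certified.py`: the adaptive engine (E101) with three separate old levels would lower the
# larger `ρ₀` of the wide cells to `≈ 45–75`; not typed here).

Cell `pub-balaban`, β-function sub-cell, BINDER row D4 «RemainderConst leaves for Bałaban's split» (`HOME/BINDER-OWNERS.md`; owner lineage `b2b-balaban-beta-an4`;
this file by co-owner #2 lineage `b2b-balaban-beta-d4-p2`, generation 89), β-FLOW TEAM duty (1), FREEZE (0) honoured (def-free; nothing restated).

HONEST FRAMING (page 1, verbatim and binding).  *"Discharging BetaPertH makes Bałaban's UV stability UNCONDITIONAL — a real constructive-QFT result; it is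
NOT the continuum limit and NOT the Clay problem."*  THIS FILE DISCHARGES NOTHING OF THE KIND.  Elementary real algebra ∕ real analysis about ABSTRACT
functionals on a box ]0,γ]^ℕ with displayed floors, profiles and signs, and the FIRST-ORDER renewal objects of route (N) built from them — hypotheses of a
census, not facts; the form, signs, ages and moments of Bałaban's (1.22) limit functional are NOT PRINTED ([I] p. 298; GAPS G-t4-U2-1∕-2) and NOT asserted.
Row D4 class UNCHANGED (critical-path width 0; instance 0∕1; D4 DISCHARGE NO DATE).  HONEST DEPENDENCY: continuum YM on T⁴ ⇐ BetaPertH ∧ nine spine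
estimates (0/9 proved); BetaPertH ⇐ (D1) ∧ (D4) ∧ CAP+tail; G-an2-4 gates asym, D1 and NE2/3/4.

THE POINT (README `HOME/b2b-balaban-beta-d4-p2/g89/README.md` §4).  Uses (E104a) `flow_nonneg_census_young_pair_old_triple_of_cap`, (E104b) `flow_nonneg_census_five_ages_top8`, (E103u–zb) `old_triple_load_le_c2g … cg8` BY NAME.  NOT CLAIMED: `k₂ ≥ 30`; `k₃ < ρ₀k₂`; the cell `(8,16]²`; six or
more ages; anything printed — NOT B12 Thm 2, NOT BetaPertH, NOT continuum, NOT Clay.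

WHAT IS PROVED ([folklore]; 0 `def`, 0 sorry).  See the list above.
-/
noncomputable section
open Finset

namespace Summit.QuantumFields.BalabanUV.Beta.EriceRemainderEnclosureHistoryAutonomyComparisonAgeCompositionFiveAgesOneBlockWidest

open Literature.MathematicalPhysics.QuantumFieldTheory.Balaban1983to89
open Literature.MathematicalPhysics.QuantumFieldTheory.Balaban1983to89.T4BetaStationary
open Literature.MathematicalPhysics.QuantumFieldTheory.Balaban1983to89.T4BetaFlowWellPosed
open Summit.QuantumFields.BalabanUV.Beta.EriceRemainderEnclosureHistoryAutonomyComparisonAgeCompositionFiveAgesOneBlock (flow_nonneg_census_young_pair_old_triple_of_cap)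
open Summit.QuantumFields.BalabanUV.Beta.EriceRemainderEnclosureHistoryAutonomyComparisonAgeCompositionFiveAgesOneBlockWide
open Summit.QuantumFields.BalabanUV.Beta.EriceRemainderEnclosureHistoryAutonomyComparisonAgeCompositionOldTripleCapC2G (old_triple_load_le_c2g)
open Summit.QuantumFields.BalabanUV.Beta.EriceRemainderEnclosureHistoryAutonomyComparisonAgeCompositionOldTripleCapCG2 (old_triple_load_le_cg2)
open Summit.QuantumFields.BalabanUV.Beta.EriceRemainderEnclosureHistoryAutonomyComparisonAgeCompositionOldTripleCapC3G (old_triple_load_le_c3g)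
open Summit.QuantumFields.BalabanUV.Beta.EriceRemainderEnclosureHistoryAutonomyComparisonAgeCompositionOldTripleCapCG3 (old_triple_load_le_cg3)
open Summit.QuantumFields.BalabanUV.Beta.EriceRemainderEnclosureHistoryAutonomyComparisonAgeCompositionOldTripleCapC4G (old_triple_load_le_c4g)
open Summit.QuantumFields.BalabanUV.Beta.EriceRemainderEnclosureHistoryAutonomyComparisonAgeCompositionOldTripleCapCG4 (old_triple_load_le_cg4)
open Summit.QuantumFields.BalabanUV.Beta.EriceRemainderEnclosureHistoryAutonomyComparisonAgeCompositionOldTripleCapC8G (old_triple_load_le_c8g)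
open Summit.QuantumFields.BalabanUV.Beta.EriceRemainderEnclosureHistoryAutonomyComparisonAgeCompositionOldTripleCapCG8 (old_triple_load_le_cg8)

variable {B : (ℕ → ℝ) → ℝ} {γ b gIR : ℝ} {L : ℕ → ℝ} {K : ℕ} {h g : ℕ → ℝ}

/-! ## §1 The cells with a top ratio in `(8, 16]` -/

/-- **THE CENSUS FIVE AGES `{1, k₂, k₃, k₄, k₅}` ON THE CELL `k₄∕k₃ ∈ (1,2]`, `k₅∕k₄ ∈ (8,16]`:** `2 ≤ k₂ ≤ 29`, `115·k₂ ≤ k₃`: `0 ≤ ε ≤ e` at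
every pin, every horizon, every damping of the self-consistent class (§1 with the triple cap `17 / 20` of `old_triple_load_le_c2g`, `κ = 1∕1000`,
`ρ₀ = 115`). [folklore] -/
theorem flow_nonneg_census_five_ages_c2g
    (hmono : ∀ u v : ℕ → ℝ, SeqBox γ u → SeqBox γ v → (∀ j, u j ≤ v j) → B u ≤ B v)
    (hL : ∀ k, 0 ≤ L k) (hb : 0 < b) (hlo : ∀ u, SeqBox γ u → b ≤ B u) (hdom : ∀ u, SeqBox γ u → ∑ k ∈ range K, L k * u k ≤ B u)
    (hh : SeqBox γ h) (hf : MemFlow B gIR h) (hg : ∀ t, 0 < g t ∧ g t ≤ 1)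
    (hgF : ∀ t, 1 ≤ g t * (1 + ∑ k ∈ range K, L k * h (t + k) ^ 3 / 2))
    {k₂ k₃ k₄ k₅ : ℕ} (hk2 : 2 ≤ k₂) (hk29 : k₂ ≤ 29) (hk3 : 115 * k₂ ≤ k₃)
    (h34l : 1 * k₃ < k₄) (h34h : k₄ ≤ 2 * k₃) (h45l : 8 * k₄ < k₅) (h45h : k₅ ≤ 16 * k₄) (hk5K : k₅ < K)
    (hLa : ∀ l, l < K → l ≠ 1 → l ≠ k₂ → l ≠ k₃ → l ≠ k₄ → l ≠ k₅ → L l = 0)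
    {N : ℕ} {KL : ℕ → ℕ → ℕ → ℝ}
    (hKL : ∀ k n l, KL k n l = if 0 < k ∧ k < K ∧ l < k then L k * h (n + k) ^ 3 / 2 * ∏ t ∈ Ico (n + 1 + l) (n + k + 1), g t else 0)
    {KA : ℕ → ℕ → ℕ → ℝ} {RA : ℕ → (ℕ → ℝ) → ℕ → ℝ}
    (hRA : ∀ i v m, RA i v m = ∑ l ∈ range K, KA i m l * v (m + 1 + l))
    (hKA : ∀ i m l, KA i m l = KL i m l + KA (i + 1) m l) (hKAtop : ∀ m l, KA K m l = 0)
    {e ε : ℕ → ℝ} (he0 : ∀ m, 0 ≤ e m) (hea : ∀ m, e (m + 1) ≤ e m)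
    (hεt : ∀ m, N < m → ε m = 0) (hεrec : ∀ m, ε m = e m - RA 1 ε m) : ∀ m, 0 ≤ ε m ∧ ε m ≤ e m :=
  flow_nonneg_census_young_pair_old_triple_of_cap hmono hL hb hlo hdom hh hf hg hgF hk2 hk29 (by omega) (by omega) (by omega) hk5K
    (s := 17 / 20) (κ := 1 / 1000) (ρ₀ := 115) (by norm_num) (by norm_num) (by norm_num) (by norm_num) (by norm_num) hk3
    (fun q => old_triple_load_le_c2g hmono hL hb hlo hdom hh hf (by omega) h34l h34h h45l h45h hk5K q) hLa hKL hRA hKA hKAtop he0 hea hεt hεrec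

/-- **THE CENSUS FIVE AGES `{1, k₂, k₃, k₄, k₅}` ON THE CELL `k₄∕k₃ ∈ (8,16]`, `k₅∕k₄ ∈ (1,2]`:** `2 ≤ k₂ ≤ 29`, `124·k₂ ≤ k₃`: `0 ≤ ε ≤ e` at
every pin, every horizon, every damping of the self-consistent class (§1 with the triple cap `43 / 50` of `old_triple_load_le_cg2`, `κ = 1∕1000`,
`ρ₀ = 124`). [folklore] -/
theorem flow_nonneg_census_five_ages_cg2
    (hmono : ∀ u v : ℕ → ℝ, SeqBox γ u → SeqBox γ v → (∀ j, u j ≤ v j) → B u ≤ B v)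
    (hL : ∀ k, 0 ≤ L k) (hb : 0 < b) (hlo : ∀ u, SeqBox γ u → b ≤ B u) (hdom : ∀ u, SeqBox γ u → ∑ k ∈ range K, L k * u k ≤ B u)
    (hh : SeqBox γ h) (hf : MemFlow B gIR h) (hg : ∀ t, 0 < g t ∧ g t ≤ 1)
    (hgF : ∀ t, 1 ≤ g t * (1 + ∑ k ∈ range K, L k * h (t + k) ^ 3 / 2))
    {k₂ k₃ k₄ k₅ : ℕ} (hk2 : 2 ≤ k₂) (hk29 : k₂ ≤ 29) (hk3 : 124 * k₂ ≤ k₃)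
    (h34l : 8 * k₃ < k₄) (h34h : k₄ ≤ 16 * k₃) (h45l : 1 * k₄ < k₅) (h45h : k₅ ≤ 2 * k₄) (hk5K : k₅ < K)
    (hLa : ∀ l, l < K → l ≠ 1 → l ≠ k₂ → l ≠ k₃ → l ≠ k₄ → l ≠ k₅ → L l = 0)
    {N : ℕ} {KL : ℕ → ℕ → ℕ → ℝ}
    (hKL : ∀ k n l, KL k n l = if 0 < k ∧ k < K ∧ l < k then L k * h (n + k) ^ 3 / 2 * ∏ t ∈ Ico (n + 1 + l) (n + k + 1), g t else 0)
    {KA : ℕ → ℕ → ℕ → ℝ} {RA : ℕ → (ℕ → ℝ) → ℕ → ℝ}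
    (hRA : ∀ i v m, RA i v m = ∑ l ∈ range K, KA i m l * v (m + 1 + l))
    (hKA : ∀ i m l, KA i m l = KL i m l + KA (i + 1) m l) (hKAtop : ∀ m l, KA K m l = 0)
    {e ε : ℕ → ℝ} (he0 : ∀ m, 0 ≤ e m) (hea : ∀ m, e (m + 1) ≤ e m)
    (hεt : ∀ m, N < m → ε m = 0) (hεrec : ∀ m, ε m = e m - RA 1 ε m) : ∀ m, 0 ≤ ε m ∧ ε m ≤ e m :=
  flow_nonneg_census_young_pair_old_triple_of_cap hmono hL hb hlo hdom hh hf hg hgF hk2 hk29 (by omega) (by omega) (by omega) hk5K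
    (s := 43 / 50) (κ := 1 / 1000) (ρ₀ := 124) (by norm_num) (by norm_num) (by norm_num) (by norm_num) (by norm_num) hk3
    (fun q => old_triple_load_le_cg2 hmono hL hb hlo hdom hh hf (by omega) h34l h34h h45l h45h hk5K q) hLa hKL hRA hKA hKAtop he0 hea hεt hεrec

/-- **THE CENSUS FIVE AGES `{1, k₂, k₃, k₄, k₅}` ON THE CELL `k₄∕k₃ ∈ (2,3]`, `k₅∕k₄ ∈ (8,16]`:** `2 ≤ k₂ ≤ 29`, `124·k₂ ≤ k₃`: `0 ≤ ε ≤ e` at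
every pin, every horizon, every damping of the self-consistent class (§1 with the triple cap `43 / 50` of `old_triple_load_le_c3g`, `κ = 1∕1000`,
`ρ₀ = 124`). [folklore] -/
theorem flow_nonneg_census_five_ages_c3g
    (hmono : ∀ u v : ℕ → ℝ, SeqBox γ u → SeqBox γ v → (∀ j, u j ≤ v j) → B u ≤ B v)
    (hL : ∀ k, 0 ≤ L k) (hb : 0 < b) (hlo : ∀ u, SeqBox γ u → b ≤ B u) (hdom : ∀ u, SeqBox γ u → ∑ k ∈ range K, L k * u k ≤ B u)
    (hh : SeqBox γ h) (hf : MemFlow B gIR h) (hg : ∀ t, 0 < g t ∧ g t ≤ 1)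
    (hgF : ∀ t, 1 ≤ g t * (1 + ∑ k ∈ range K, L k * h (t + k) ^ 3 / 2))
    {k₂ k₃ k₄ k₅ : ℕ} (hk2 : 2 ≤ k₂) (hk29 : k₂ ≤ 29) (hk3 : 124 * k₂ ≤ k₃)
    (h34l : 2 * k₃ < k₄) (h34h : k₄ ≤ 3 * k₃) (h45l : 8 * k₄ < k₅) (h45h : k₅ ≤ 16 * k₄) (hk5K : k₅ < K)
    (hLa : ∀ l, l < K → l ≠ 1 → l ≠ k₂ → l ≠ k₃ → l ≠ k₄ → l ≠ k₅ → L l = 0)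
    {N : ℕ} {KL : ℕ → ℕ → ℕ → ℝ}
    (hKL : ∀ k n l, KL k n l = if 0 < k ∧ k < K ∧ l < k then L k * h (n + k) ^ 3 / 2 * ∏ t ∈ Ico (n + 1 + l) (n + k + 1), g t else 0)
    {KA : ℕ → ℕ → ℕ → ℝ} {RA : ℕ → (ℕ → ℝ) → ℕ → ℝ}
    (hRA : ∀ i v m, RA i v m = ∑ l ∈ range K, KA i m l * v (m + 1 + l))
    (hKA : ∀ i m l, KA i m l = KL i m l + KA (i + 1) m l) (hKAtop : ∀ m l, KA K m l = 0)
    {e ε : ℕ → ℝ} (he0 : ∀ m, 0 ≤ e m) (hea : ∀ m, e (m + 1) ≤ e m)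
    (hεt : ∀ m, N < m → ε m = 0) (hεrec : ∀ m, ε m = e m - RA 1 ε m) : ∀ m, 0 ≤ ε m ∧ ε m ≤ e m :=
  flow_nonneg_census_young_pair_old_triple_of_cap hmono hL hb hlo hdom hh hf hg hgF hk2 hk29 (by omega) (by omega) (by omega) hk5K
    (s := 43 / 50) (κ := 1 / 1000) (ρ₀ := 124) (by norm_num) (by norm_num) (by norm_num) (by norm_num) (by norm_num) hk3
    (fun q => old_triple_load_le_c3g hmono hL hb hlo hdom hh hf (by omega) h34l h34h h45l h45h hk5K q) hLa hKL hRA hKA hKAtop he0 hea hεt hεrec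

/-- **THE CENSUS FIVE AGES `{1, k₂, k₃, k₄, k₅}` ON THE CELL `k₄∕k₃ ∈ (8,16]`, `k₅∕k₄ ∈ (2,3]`:** `2 ≤ k₂ ≤ 29`, `148·k₂ ≤ k₃`: `0 ≤ ε ≤ e` at
every pin, every horizon, every damping of the self-consistent class (§1 with the triple cap `22 / 25` of `old_triple_load_le_cg3`, `κ = 1∕1000`,
`ρ₀ = 148`). [folklore] -/
theorem flow_nonneg_census_five_ages_cg3
    (hmono : ∀ u v : ℕ → ℝ, SeqBox γ u → SeqBox γ v → (∀ j, u j ≤ v j) → B u ≤ B v)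
    (hL : ∀ k, 0 ≤ L k) (hb : 0 < b) (hlo : ∀ u, SeqBox γ u → b ≤ B u) (hdom : ∀ u, SeqBox γ u → ∑ k ∈ range K, L k * u k ≤ B u)
    (hh : SeqBox γ h) (hf : MemFlow B gIR h) (hg : ∀ t, 0 < g t ∧ g t ≤ 1)
    (hgF : ∀ t, 1 ≤ g t * (1 + ∑ k ∈ range K, L k * h (t + k) ^ 3 / 2))
    {k₂ k₃ k₄ k₅ : ℕ} (hk2 : 2 ≤ k₂) (hk29 : k₂ ≤ 29) (hk3 : 148 * k₂ ≤ k₃)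
    (h34l : 8 * k₃ < k₄) (h34h : k₄ ≤ 16 * k₃) (h45l : 2 * k₄ < k₅) (h45h : k₅ ≤ 3 * k₄) (hk5K : k₅ < K)
    (hLa : ∀ l, l < K → l ≠ 1 → l ≠ k₂ → l ≠ k₃ → l ≠ k₄ → l ≠ k₅ → L l = 0)
    {N : ℕ} {KL : ℕ → ℕ → ℕ → ℝ}
    (hKL : ∀ k n l, KL k n l = if 0 < k ∧ k < K ∧ l < k then L k * h (n + k) ^ 3 / 2 * ∏ t ∈ Ico (n + 1 + l) (n + k + 1), g t else 0)
    {KA : ℕ → ℕ → ℕ → ℝ} {RA : ℕ → (ℕ → ℝ) → ℕ → ℝ}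
    (hRA : ∀ i v m, RA i v m = ∑ l ∈ range K, KA i m l * v (m + 1 + l))
    (hKA : ∀ i m l, KA i m l = KL i m l + KA (i + 1) m l) (hKAtop : ∀ m l, KA K m l = 0)
    {e ε : ℕ → ℝ} (he0 : ∀ m, 0 ≤ e m) (hea : ∀ m, e (m + 1) ≤ e m)
    (hεt : ∀ m, N < m → ε m = 0) (hεrec : ∀ m, ε m = e m - RA 1 ε m) : ∀ m, 0 ≤ ε m ∧ ε m ≤ e m :=
  flow_nonneg_census_young_pair_old_triple_of_cap hmono hL hb hlo hdom hh hf hg hgF hk2 hk29 (by omega) (by omega) (by omega) hk5K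
    (s := 22 / 25) (κ := 1 / 1000) (ρ₀ := 148) (by norm_num) (by norm_num) (by norm_num) (by norm_num) (by norm_num) hk3
    (fun q => old_triple_load_le_cg3 hmono hL hb hlo hdom hh hf (by omega) h34l h34h h45l h45h hk5K q) hLa hKL hRA hKA hKAtop he0 hea hεt hεrec

/-- **THE CENSUS FIVE AGES `{1, k₂, k₃, k₄, k₅}` ON THE CELL `k₄∕k₃ ∈ (3,4]`, `k₅∕k₄ ∈ (8,16]`:** `2 ≤ k₂ ≤ 29`, `148·k₂ ≤ k₃`: `0 ≤ ε ≤ e` at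
every pin, every horizon, every damping of the self-consistent class (§1 with the triple cap `22 / 25` of `old_triple_load_le_c4g`, `κ = 1∕1000`,
`ρ₀ = 148`). [folklore] -/
theorem flow_nonneg_census_five_ages_c4g
    (hmono : ∀ u v : ℕ → ℝ, SeqBox γ u → SeqBox γ v → (∀ j, u j ≤ v j) → B u ≤ B v)
    (hL : ∀ k, 0 ≤ L k) (hb : 0 < b) (hlo : ∀ u, SeqBox γ u → b ≤ B u) (hdom : ∀ u, SeqBox γ u → ∑ k ∈ range K, L k * u k ≤ B u)
    (hh : SeqBox γ h) (hf : MemFlow B gIR h) (hg : ∀ t, 0 < g t ∧ g t ≤ 1)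
    (hgF : ∀ t, 1 ≤ g t * (1 + ∑ k ∈ range K, L k * h (t + k) ^ 3 / 2))
    {k₂ k₃ k₄ k₅ : ℕ} (hk2 : 2 ≤ k₂) (hk29 : k₂ ≤ 29) (hk3 : 148 * k₂ ≤ k₃)
    (h34l : 3 * k₃ < k₄) (h34h : k₄ ≤ 4 * k₃) (h45l : 8 * k₄ < k₅) (h45h : k₅ ≤ 16 * k₄) (hk5K : k₅ < K)
    (hLa : ∀ l, l < K → l ≠ 1 → l ≠ k₂ → l ≠ k₃ → l ≠ k₄ → l ≠ k₅ → L l = 0)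
    {N : ℕ} {KL : ℕ → ℕ → ℕ → ℝ}
    (hKL : ∀ k n l, KL k n l = if 0 < k ∧ k < K ∧ l < k then L k * h (n + k) ^ 3 / 2 * ∏ t ∈ Ico (n + 1 + l) (n + k + 1), g t else 0)
    {KA : ℕ → ℕ → ℕ → ℝ} {RA : ℕ → (ℕ → ℝ) → ℕ → ℝ}
    (hRA : ∀ i v m, RA i v m = ∑ l ∈ range K, KA i m l * v (m + 1 + l))
    (hKA : ∀ i m l, KA i m l = KL i m l + KA (i + 1) m l) (hKAtop : ∀ m l, KA K m l = 0)
    {e ε : ℕ → ℝ} (he0 : ∀ m, 0 ≤ e m) (hea : ∀ m, e (m + 1) ≤ e m)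
    (hεt : ∀ m, N < m → ε m = 0) (hεrec : ∀ m, ε m = e m - RA 1 ε m) : ∀ m, 0 ≤ ε m ∧ ε m ≤ e m :=
  flow_nonneg_census_young_pair_old_triple_of_cap hmono hL hb hlo hdom hh hf hg hgF hk2 hk29 (by omega) (by omega) (by omega) hk5K
    (s := 22 / 25) (κ := 1 / 1000) (ρ₀ := 148) (by norm_num) (by norm_num) (by norm_num) (by norm_num) (by norm_num) hk3
    (fun q => old_triple_load_le_c4g hmono hL hb hlo hdom hh hf (by omega) h34l h34h h45l h45h hk5K q) hLa hKL hRA hKA hKAtop he0 hea hεt hεrec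

/-- **THE CENSUS FIVE AGES `{1, k₂, k₃, k₄, k₅}` ON THE CELL `k₄∕k₃ ∈ (8,16]`, `k₅∕k₄ ∈ (3,4]`:** `2 ≤ k₂ ≤ 29`, `164·k₂ ≤ k₃`: `0 ≤ ε ≤ e` at
every pin, every horizon, every damping of the self-consistent class (§1 with the triple cap `89 / 100` of `old_triple_load_le_cg4`, `κ = 1∕1000`,
`ρ₀ = 164`). [folklore] -/
theorem flow_nonneg_census_five_ages_cg4
    (hmono : ∀ u v : ℕ → ℝ, SeqBox γ u → SeqBox γ v → (∀ j, u j ≤ v j) → B u ≤ B v)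
    (hL : ∀ k, 0 ≤ L k) (hb : 0 < b) (hlo : ∀ u, SeqBox γ u → b ≤ B u) (hdom : ∀ u, SeqBox γ u → ∑ k ∈ range K, L k * u k ≤ B u)
    (hh : SeqBox γ h) (hf : MemFlow B gIR h) (hg : ∀ t, 0 < g t ∧ g t ≤ 1)
    (hgF : ∀ t, 1 ≤ g t * (1 + ∑ k ∈ range K, L k * h (t + k) ^ 3 / 2))
    {k₂ k₃ k₄ k₅ : ℕ} (hk2 : 2 ≤ k₂) (hk29 : k₂ ≤ 29) (hk3 : 164 * k₂ ≤ k₃)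
    (h34l : 8 * k₃ < k₄) (h34h : k₄ ≤ 16 * k₃) (h45l : 3 * k₄ < k₅) (h45h : k₅ ≤ 4 * k₄) (hk5K : k₅ < K)
    (hLa : ∀ l, l < K → l ≠ 1 → l ≠ k₂ → l ≠ k₃ → l ≠ k₄ → l ≠ k₅ → L l = 0)
    {N : ℕ} {KL : ℕ → ℕ → ℕ → ℝ}
    (hKL : ∀ k n l, KL k n l = if 0 < k ∧ k < K ∧ l < k then L k * h (n + k) ^ 3 / 2 * ∏ t ∈ Ico (n + 1 + l) (n + k + 1), g t else 0)
    {KA : ℕ → ℕ → ℕ → ℝ} {RA : ℕ → (ℕ → ℝ) → ℕ → ℝ}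
    (hRA : ∀ i v m, RA i v m = ∑ l ∈ range K, KA i m l * v (m + 1 + l))
    (hKA : ∀ i m l, KA i m l = KL i m l + KA (i + 1) m l) (hKAtop : ∀ m l, KA K m l = 0)
    {e ε : ℕ → ℝ} (he0 : ∀ m, 0 ≤ e m) (hea : ∀ m, e (m + 1) ≤ e m)
    (hεt : ∀ m, N < m → ε m = 0) (hεrec : ∀ m, ε m = e m - RA 1 ε m) : ∀ m, 0 ≤ ε m ∧ ε m ≤ e m :=
  flow_nonneg_census_young_pair_old_triple_of_cap hmono hL hb hlo hdom hh hf hg hgF hk2 hk29 (by omega) (by omega) (by omega) hk5K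
    (s := 89 / 100) (κ := 1 / 1000) (ρ₀ := 164) (by norm_num) (by norm_num) (by norm_num) (by norm_num) (by norm_num) hk3
    (fun q => old_triple_load_le_cg4 hmono hL hb hlo hdom hh hf (by omega) h34l h34h h45l h45h hk5K q) hLa hKL hRA hKA hKAtop he0 hea hεt hεrec

/-- **THE CENSUS FIVE AGES `{1, k₂, k₃, k₄, k₅}` ON THE CELL `k₄∕k₃ ∈ (4,8]`, `k₅∕k₄ ∈ (8,16]`:** `2 ≤ k₂ ≤ 29`, `388·k₂ ≤ k₃`: `0 ≤ ε ≤ e` at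
every pin, every horizon, every damping of the self-consistent class (§1 with the triple cap `19 / 20` of `old_triple_load_le_c8g`, `κ = 1∕1000`,
`ρ₀ = 388`). [folklore] -/
theorem flow_nonneg_census_five_ages_c8g
    (hmono : ∀ u v : ℕ → ℝ, SeqBox γ u → SeqBox γ v → (∀ j, u j ≤ v j) → B u ≤ B v)
    (hL : ∀ k, 0 ≤ L k) (hb : 0 < b) (hlo : ∀ u, SeqBox γ u → b ≤ B u) (hdom : ∀ u, SeqBox γ u → ∑ k ∈ range K, L k * u k ≤ B u)
    (hh : SeqBox γ h) (hf : MemFlow B gIR h) (hg : ∀ t, 0 < g t ∧ g t ≤ 1)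
    (hgF : ∀ t, 1 ≤ g t * (1 + ∑ k ∈ range K, L k * h (t + k) ^ 3 / 2))
    {k₂ k₃ k₄ k₅ : ℕ} (hk2 : 2 ≤ k₂) (hk29 : k₂ ≤ 29) (hk3 : 388 * k₂ ≤ k₃)
    (h34l : 4 * k₃ < k₄) (h34h : k₄ ≤ 8 * k₃) (h45l : 8 * k₄ < k₅) (h45h : k₅ ≤ 16 * k₄) (hk5K : k₅ < K)
    (hLa : ∀ l, l < K → l ≠ 1 → l ≠ k₂ → l ≠ k₃ → l ≠ k₄ → l ≠ k₅ → L l = 0)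
    {N : ℕ} {KL : ℕ → ℕ → ℕ → ℝ}
    (hKL : ∀ k n l, KL k n l = if 0 < k ∧ k < K ∧ l < k then L k * h (n + k) ^ 3 / 2 * ∏ t ∈ Ico (n + 1 + l) (n + k + 1), g t else 0)
    {KA : ℕ → ℕ → ℕ → ℝ} {RA : ℕ → (ℕ → ℝ) → ℕ → ℝ}
    (hRA : ∀ i v m, RA i v m = ∑ l ∈ range K, KA i m l * v (m + 1 + l))
    (hKA : ∀ i m l, KA i m l = KL i m l + KA (i + 1) m l) (hKAtop : ∀ m l, KA K m l = 0)
    {e ε : ℕ → ℝ} (he0 : ∀ m, 0 ≤ e m) (hea : ∀ m, e (m + 1) ≤ e m)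
    (hεt : ∀ m, N < m → ε m = 0) (hεrec : ∀ m, ε m = e m - RA 1 ε m) : ∀ m, 0 ≤ ε m ∧ ε m ≤ e m :=
  flow_nonneg_census_young_pair_old_triple_of_cap hmono hL hb hlo hdom hh hf hg hgF hk2 hk29 (by omega) (by omega) (by omega) hk5K
    (s := 19 / 20) (κ := 1 / 1000) (ρ₀ := 388) (by norm_num) (by norm_num) (by norm_num) (by norm_num) (by norm_num) hk3
    (fun q => old_triple_load_le_c8g hmono hL hb hlo hdom hh hf (by omega) h34l h34h h45l h45h hk5K q) hLa hKL hRA hKA hKAtop he0 hea hεt hεrec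

/-- **THE CENSUS FIVE AGES `{1, k₂, k₃, k₄, k₅}` ON THE CELL `k₄∕k₃ ∈ (8,16]`, `k₅∕k₄ ∈ (4,8]`:** `2 ≤ k₂ ≤ 29`, `493·k₂ ≤ k₃`: `0 ≤ ε ≤ e` at
every pin, every horizon, every damping of the self-consistent class (§1 with the triple cap `24 / 25` of `old_triple_load_le_cg8`, `κ = 1∕1000`,
`ρ₀ = 493`). [folklore] -/
theorem flow_nonneg_census_five_ages_cg8
    (hmono : ∀ u v : ℕ → ℝ, SeqBox γ u → SeqBox γ v → (∀ j, u j ≤ v j) → B u ≤ B v)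
    (hL : ∀ k, 0 ≤ L k) (hb : 0 < b) (hlo : ∀ u, SeqBox γ u → b ≤ B u) (hdom : ∀ u, SeqBox γ u → ∑ k ∈ range K, L k * u k ≤ B u)
    (hh : SeqBox γ h) (hf : MemFlow B gIR h) (hg : ∀ t, 0 < g t ∧ g t ≤ 1)
    (hgF : ∀ t, 1 ≤ g t * (1 + ∑ k ∈ range K, L k * h (t + k) ^ 3 / 2))
    {k₂ k₃ k₄ k₅ : ℕ} (hk2 : 2 ≤ k₂) (hk29 : k₂ ≤ 29) (hk3 : 493 * k₂ ≤ k₃)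
    (h34l : 8 * k₃ < k₄) (h34h : k₄ ≤ 16 * k₃) (h45l : 4 * k₄ < k₅) (h45h : k₅ ≤ 8 * k₄) (hk5K : k₅ < K)
    (hLa : ∀ l, l < K → l ≠ 1 → l ≠ k₂ → l ≠ k₃ → l ≠ k₄ → l ≠ k₅ → L l = 0)
    {N : ℕ} {KL : ℕ → ℕ → ℕ → ℝ}
    (hKL : ∀ k n l, KL k n l = if 0 < k ∧ k < K ∧ l < k then L k * h (n + k) ^ 3 / 2 * ∏ t ∈ Ico (n + 1 + l) (n + k + 1), g t else 0)
    {KA : ℕ → ℕ → ℕ → ℝ} {RA : ℕ → (ℕ → ℝ) → ℕ → ℝ}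
    (hRA : ∀ i v m, RA i v m = ∑ l ∈ range K, KA i m l * v (m + 1 + l))
    (hKA : ∀ i m l, KA i m l = KL i m l + KA (i + 1) m l) (hKAtop : ∀ m l, KA K m l = 0)
    {e ε : ℕ → ℝ} (he0 : ∀ m, 0 ≤ e m) (hea : ∀ m, e (m + 1) ≤ e m)
    (hεt : ∀ m, N < m → ε m = 0) (hεrec : ∀ m, ε m = e m - RA 1 ε m) : ∀ m, 0 ≤ ε m ∧ ε m ≤ e m :=
  flow_nonneg_census_young_pair_old_triple_of_cap hmono hL hb hlo hdom hh hf hg hgF hk2 hk29 (by omega) (by omega) (by omega) hk5K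
    (s := 24 / 25) (κ := 1 / 1000) (ρ₀ := 493) (by norm_num) (by norm_num) (by norm_num) (by norm_num) (by norm_num) hk3
    (fun q => old_triple_load_le_cg8 hmono hL hb hlo hdom hh hf (by omega) h34l h34h h45l h45h hk5K q) hLa hKL hRA hKA hKAtop he0 hea hεt hεrec

/-! ## §2 The unions -/

/-- **THE CENSUS FIVE AGES, `k₄ ≤ 8k₃`, `k₅ ≤ 16k₄`.**  `2 ≤ k₂ ≤ 29`, `388k₂ ≤ k₃`, `k₃ < k₄ ≤ 8k₃`, `k₄ < k₅ ≤ 16k₄`, `k₅ < K`: `0 ≤ ε ≤ e` at every pin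
((E104b) `…_top8` and the cells `c2g, c3g, c4g, c8g`). [folklore] -/
theorem flow_nonneg_census_five_ages_top8x16
    (hmono : ∀ u v : ℕ → ℝ, SeqBox γ u → SeqBox γ v → (∀ j, u j ≤ v j) → B u ≤ B v)
    (hL : ∀ k, 0 ≤ L k) (hb : 0 < b) (hlo : ∀ u, SeqBox γ u → b ≤ B u) (hdom : ∀ u, SeqBox γ u → ∑ k ∈ range K, L k * u k ≤ B u)
    (hh : SeqBox γ h) (hf : MemFlow B gIR h) (hg : ∀ t, 0 < g t ∧ g t ≤ 1)
    (hgF : ∀ t, 1 ≤ g t * (1 + ∑ k ∈ range K, L k * h (t + k) ^ 3 / 2))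
    {k₂ k₃ k₄ k₅ : ℕ} (hk2 : 2 ≤ k₂) (hk29 : k₂ ≤ 29) (hk3 : 388 * k₂ ≤ k₃)
    (h34l : k₃ < k₄) (h34h : k₄ ≤ 8 * k₃) (h45l : k₄ < k₅) (h45h : k₅ ≤ 16 * k₄) (hk5K : k₅ < K)
    (hLa : ∀ l, l < K → l ≠ 1 → l ≠ k₂ → l ≠ k₃ → l ≠ k₄ → l ≠ k₅ → L l = 0)
    {N : ℕ} {KL : ℕ → ℕ → ℕ → ℝ}
    (hKL : ∀ k n l, KL k n l = if 0 < k ∧ k < K ∧ l < k then L k * h (n + k) ^ 3 / 2 * ∏ t ∈ Ico (n + 1 + l) (n + k + 1), g t else 0)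
    {KA : ℕ → ℕ → ℕ → ℝ} {RA : ℕ → (ℕ → ℝ) → ℕ → ℝ}
    (hRA : ∀ i v m, RA i v m = ∑ l ∈ range K, KA i m l * v (m + 1 + l))
    (hKA : ∀ i m l, KA i m l = KL i m l + KA (i + 1) m l) (hKAtop : ∀ m l, KA K m l = 0)
    {e ε : ℕ → ℝ} (he0 : ∀ m, 0 ≤ e m) (hea : ∀ m, e (m + 1) ≤ e m)
    (hεt : ∀ m, N < m → ε m = 0) (hεrec : ∀ m, ε m = e m - RA 1 ε m) : ∀ m, 0 ≤ ε m ∧ ε m ≤ e m := by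
  rcases le_or_gt k₅ (8 * k₄) with hb' | hb'
  · exact flow_nonneg_census_five_ages_top8 hmono hL hb hlo hdom hh hf hg hgF hk2 hk29 (by omega) h34l h34h h45l hb' hk5K hLa
      hKL hRA hKA hKAtop he0 hea hεt hεrec
  rcases le_or_gt k₄ (2 * k₃) with h2 | h2
  · exact flow_nonneg_census_five_ages_c2g hmono hL hb hlo hdom hh hf hg hgF hk2 hk29 (by omega) (by omega) h2 (by omega) h45h hk5K hLa
      hKL hRA hKA hKAtop he0 hea hεt hεrec
  rcases le_or_gt k₄ (3 * k₃) with h3 | h3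
  · exact flow_nonneg_census_five_ages_c3g hmono hL hb hlo hdom hh hf hg hgF hk2 hk29 (by omega) (by omega) h3 (by omega) h45h hk5K hLa
      hKL hRA hKA hKAtop he0 hea hεt hεrec
  rcases le_or_gt k₄ (4 * k₃) with h4 | h4
  · exact flow_nonneg_census_five_ages_c4g hmono hL hb hlo hdom hh hf hg hgF hk2 hk29 (by omega) (by omega) h4 (by omega) h45h hk5K hLa
      hKL hRA hKA hKAtop he0 hea hεt hεrec
  · exact flow_nonneg_census_five_ages_c8g hmono hL hb hlo hdom hh hf hg hgF hk2 hk29 (by omega) (by omega) h34h (by omega) h45h hk5K hLa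
      hKL hRA hKA hKAtop he0 hea hεt hεrec

/-- **THE CENSUS FIVE AGES, `k₄ ≤ 16k₃`, `k₅ ≤ 8k₄`.**  `2 ≤ k₂ ≤ 29`, `493k₂ ≤ k₃`, `k₃ < k₄ ≤ 16k₃`, `k₄ < k₅ ≤ 8k₄`, `k₅ < K`: `0 ≤ ε ≤ e` at every pin
((E104b) `…_top8` and the cells `cg2, cg3, cg4, cg8`). [folklore] -/
theorem flow_nonneg_census_five_ages_top16x8
    (hmono : ∀ u v : ℕ → ℝ, SeqBox γ u → SeqBox γ v → (∀ j, u j ≤ v j) → B u ≤ B v)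
    (hL : ∀ k, 0 ≤ L k) (hb : 0 < b) (hlo : ∀ u, SeqBox γ u → b ≤ B u) (hdom : ∀ u, SeqBox γ u → ∑ k ∈ range K, L k * u k ≤ B u)
    (hh : SeqBox γ h) (hf : MemFlow B gIR h) (hg : ∀ t, 0 < g t ∧ g t ≤ 1)
    (hgF : ∀ t, 1 ≤ g t * (1 + ∑ k ∈ range K, L k * h (t + k) ^ 3 / 2))
    {k₂ k₃ k₄ k₅ : ℕ} (hk2 : 2 ≤ k₂) (hk29 : k₂ ≤ 29) (hk3 : 493 * k₂ ≤ k₃)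
    (h34l : k₃ < k₄) (h34h : k₄ ≤ 16 * k₃) (h45l : k₄ < k₅) (h45h : k₅ ≤ 8 * k₄) (hk5K : k₅ < K)
    (hLa : ∀ l, l < K → l ≠ 1 → l ≠ k₂ → l ≠ k₃ → l ≠ k₄ → l ≠ k₅ → L l = 0)
    {N : ℕ} {KL : ℕ → ℕ → ℕ → ℝ}
    (hKL : ∀ k n l, KL k n l = if 0 < k ∧ k < K ∧ l < k then L k * h (n + k) ^ 3 / 2 * ∏ t ∈ Ico (n + 1 + l) (n + k + 1), g t else 0)
    {KA : ℕ → ℕ → ℕ → ℝ} {RA : ℕ → (ℕ → ℝ) → ℕ → ℝ}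
    (hRA : ∀ i v m, RA i v m = ∑ l ∈ range K, KA i m l * v (m + 1 + l))
    (hKA : ∀ i m l, KA i m l = KL i m l + KA (i + 1) m l) (hKAtop : ∀ m l, KA K m l = 0)
    {e ε : ℕ → ℝ} (he0 : ∀ m, 0 ≤ e m) (hea : ∀ m, e (m + 1) ≤ e m)
    (hεt : ∀ m, N < m → ε m = 0) (hεrec : ∀ m, ε m = e m - RA 1 ε m) : ∀ m, 0 ≤ ε m ∧ ε m ≤ e m := by
  rcases le_or_gt k₄ (8 * k₃) with ha | ha
  · exact flow_nonneg_census_five_ages_top8 hmono hL hb hlo hdom hh hf hg hgF hk2 hk29 (by omega) h34l ha h45l h45h hk5K hLa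
      hKL hRA hKA hKAtop he0 hea hεt hεrec
  rcases le_or_gt k₅ (2 * k₄) with h2 | h2
  · exact flow_nonneg_census_five_ages_cg2 hmono hL hb hlo hdom hh hf hg hgF hk2 hk29 (by omega) (by omega) h34h (by omega) h2 hk5K hLa
      hKL hRA hKA hKAtop he0 hea hεt hεrec
  rcases le_or_gt k₅ (3 * k₄) with h3 | h3
  · exact flow_nonneg_census_five_ages_cg3 hmono hL hb hlo hdom hh hf hg hgF hk2 hk29 (by omega) (by omega) h34h (by omega) h3 hk5K hLa
      hKL hRA hKA hKAtop he0 hea hεt hεrec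
  rcases le_or_gt k₅ (4 * k₄) with h4 | h4
  · exact flow_nonneg_census_five_ages_cg4 hmono hL hb hlo hdom hh hf hg hgF hk2 hk29 (by omega) (by omega) h34h (by omega) h4 hk5K hLa
      hKL hRA hKA hKAtop he0 hea hεt hεrec
  · exact flow_nonneg_census_five_ages_cg8 hmono hL hb hlo hdom hh hf hg hgF hk2 hk29 (by omega) (by omega) h34h (by omega) h45h hk5K hLa
      hKL hRA hKA hKAtop he0 hea hεt hεrec

end Summit.QuantumFields.BalabanUV.Beta.EriceRemainderEnclosureHistoryAutonomyComparisonAgeCompositionFiveAgesOneBlockWidest
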